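import Summits.Ventures.GridStability.Models.InverterDroopFirstOrderVICCT
import Summits.Ventures.GridStability.Models.InverterDroopCSAQoriaP08
import Summits.Ventures.GridStability.Models.InverterDroopVIData

/-!
# GridStability/Models/InverterDroopVIQoriaP08 — instance «QORIA-V3-VI-P08»: the printed virtual-impedance clearing-time case of Qoria 2020 §V.3 with certified numerals — `0.1654 s < t_cVI′ < 0.1655 s` (PRINTED 165 ms) and the certified ranking `t_cSAT′ < t_cVI′ < t_cc′`

Cell `gridfusion` (LADDER-GRIDFUSION, apex line G3.a; seat gridfusion-model-3 (g10); models/MODEL-3-NOTES.md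
§1 (P31); rider of ★ #106 / «#106′ QORIA-V3-CSA-P08»).  Generic theorems: `InverterDroopFirstOrderVICCT.lean`;
the droop record, `δ₀′`, `δ_maxSAT′` and their certified enclosures: `InverterDroopCSAQoriaP08.lean` (p549392,
SAME operating point `p* = 0.8`, `P_max = 4`, `m_p = 1/25`, A1″ `p*′ = 7920/9901`, `δ₀′ = arcsin(1980/9901)`).
PRINTED CASE [cite: Qoria2020, §V.3.4–§V.3.5]: «for `p* = 0.8` p.u, the maximum fault duration based on VI is
`t_cVI = 165` ms, whereas … based on CSA is `t_cSAT = 63.7` ms»; Fig. V-16: `t_fault = 165` ms recovers,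
`175` ms loses [corpus:paper:galaxy-pdf-947812980 p0110 L23–L31].
VI-CURVE DATA (V-18) and its PROVENANCE (three columns kept apart):
* PRINTED: `I_maxVI = 1.2` p.u., `σ_X/R = 5`, `k_pRVI(VSC) = 0.6716` p.u. [Table V-1, p0106]; (V-6)–(V-7) at
  `I_s = I_max`: `X_VImax = k_pRVI σ_X/R (I_maxVI − I_n) = 0.6716`, `R_VImax = X_VImax/σ_X/R = 0.13432` (`I_n = 1`);
  `X_c = 0.15`, `R_c = 0.005` [Table II-2, p0040]; `X_g = 1/SCR = 0.1` [§V SCR = 10].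
* COMPOSED (MODEL-VALIDITY rows, model-2): P-INV-9 `V_m′ := 1` (the print's (V-18) carries the modulated
  voltage `V_m′` as a symbol, no value); P-INV-10 `R_g := 0.005` (the grid resistance of Table III-1 carried to
  the SCR = 10 case); hence `X_T = 0.9216`, `R_T = 0.14432`.
* A1-STYLE EXACT REPRESENTATION (`InverterDroopVIData.lean`): the impedance angle by the circle point `t = 20/257` —
  `sin φ′ = 10280/66449`, `cos φ′ = 65649/66449` (`φ′ = 0.155329`, vs `arctan(R_T/X_T) = 0.155336`); the
  VI-curve σ-angle by the circle point `t = 49/78` — `sin δ₁′ = 7644/8485`, `cos δ₁′ = 3683/8485`; and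
  `Z_T′ := (sin δ₁′ − sin φ′)/p*′` so that the VI-curve balance `(V_eV_m′/Z_T′) sin δ₁′ = p*′ + V_e² sin φ′/Z_T′`
  is EXACT with `V_e = V_m′ = 1` (`Z_T′ = 0.932818` vs `√(X_T²+R_T²) = 0.932832`; `R_T′ = Z_T′ sin φ′ = 0.144312`,
  `X_T′ = Z_T′ cos φ′ = 0.921587` — within `2·10⁻⁵` of the composed values, below the P-INV-10 uncertainty).
WHAT IS CERTIFIED (kernel numerals, model-1's `AngleEnclosure` chains): `0.1553 < φ′ < 0.1554`,
`1.1217 < δ₁′ < 1.1219`, hence with `0.2013 < δ₀′ < 0.2014` (p549392) and `k_i p*′ = 11246400/1118813`: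
**`0.1654 s < t_cVI′ < 0.1655 s`** (`t_cVI′ = (δ_maxVI′ − δ₀′)/(k_i p*′)`, `δ_maxVI′ = π − δ₁′ − φ′`; float
`165.45` ms; PRINTED 165 ms — the VALIDATED comparator on the nose, and PROVENANCE P-INV-8 settled: the
`arccos` reading of (V-20) would give 232 ms); the certified RANKING `t_cSAT′ < t_cVI′ < t_cc′`
(`< 0.0637 < 0.1654`, `0.1655 < 0.272`); and the hypothesis-free dichotomy sentences `vi_recovers` (every
`t_f ≤ 0.1654` s, every VI release instant) / `vi_loses` (every `t_f ∈ [0.1655, 0.5]` s with the VI kept at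
its maximum).  THREE COLUMNS.  CERTIFIED: about MODEL M_droop1+VI (first-order droop GFM, MV-6D filter-less,
maximal-VI quasi-static curve (V-18) while the VI acts, release instant an input, bolted fault `p_mes ≡ 0`,
MV-P, P-INV-7/8/9/10).  VALIDATED: printed 165 ms / Fig. V-16.  Nothing here says a converter is stable.
-/

noncomputable section

open Real Set Filter Topology
open Summit.Ventures.GridStability.Models.AngleEnclosure

namespace Summit.Ventures.GridStability.Models.InverterDroop

/-! ## §1 The VI-curve data of record: `InverterDroopVIData.lean` (`qoriaV3VI_sφ/cφ/φ/s1/c1/δ1/Z/RT/XT/δmax`) -/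

namespace qoriaV3p08

/-! ## §2 Exact facts -/

/-- `sin φ′ = 10280/66449`. -/
theorem sin_φ : sin qoriaV3VI_φ = qoriaV3VI_sφ := by
  unfold qoriaV3VI_φ qoriaV3VI_sφ; rw [sin_arcsin] <;> norm_num

/-- `cos φ′ = 65649/66449`. -/
theorem cos_φ : cos qoriaV3VI_φ = qoriaV3VI_cφ := by
  unfold qoriaV3VI_φ qoriaV3VI_cφ
  rw [cos_arcsin]
  have h : (1 : ℝ) - (10280 / 66449) ^ 2 = (65649 / 66449) ^ 2 := by norm_num
  rw [h, sqrt_sq]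
  norm_num

/-- `sin δ₁′ = 7644/8485`. -/
theorem sin_δ1 : sin qoriaV3VI_δ1 = qoriaV3VI_s1 := by
  unfold qoriaV3VI_δ1 qoriaV3VI_s1; rw [sin_arcsin] <;> norm_num

/-- `cos δ₁′ = 3683/8485`. -/
theorem cos_δ1 : cos qoriaV3VI_δ1 = qoriaV3VI_c1 := by
  unfold qoriaV3VI_δ1 qoriaV3VI_c1
  rw [cos_arcsin]
  have h : (1 : ℝ) - (7644 / 8485) ^ 2 = (3683 / 8485) ^ 2 := by norm_num
  rw [h, sqrt_sq]
  norm_num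

/-- `Z_T′ ≠ 0`, indeed `Z_T′ > 0`. -/
theorem Z_pos : 0 < qoriaV3VI_Z := by unfold qoriaV3VI_Z; norm_num

/-- `R_T′ = Z_T′ sin φ′` and `X_T′ = Z_T′ cos φ′` (the hypotheses `hR`/`hX` of the generic theorems). -/
theorem RT_XT_eq : qoriaV3VI_RT = qoriaV3VI_Z * sin qoriaV3VI_φ ∧ qoriaV3VI_XT = qoriaV3VI_Z * cos qoriaV3VI_φ := by
  rw [sin_φ, cos_φ]; exact ⟨rfl, rfl⟩

/-- **VI-curve power balance, EXACT** (`V_e = V_m′ = 1`): `(1/Z_T′) sin δ₁′ = p*′ + sin φ′/Z_T′`. -/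
theorem vi_balance :
    1 * 1 / qoriaV3VI_Z * sin qoriaV3VI_δ1 = qoriaV3p08.pref + 1 ^ 2 * sin qoriaV3VI_φ / qoriaV3VI_Z := by
  rw [sin_δ1, sin_φ]
  have hZ := Z_pos.ne'
  unfold qoriaV3VI_s1 qoriaV3VI_sφ qoriaV3p08
  unfold qoriaV3VI_Z at hZ ⊢
  field_simp
  norm_num

/-- `φ′ ∈ [0, π/2)` and `δ₁′ ∈ (−π/2, π/2)`; `δ₀′ ≤ δ₁′ − φ′` (the VI curve's rest angle exceeds the unlimited
one: `0.2014 < 1.1217 − 0.1554`). -/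
theorem angles_mem :
    0 ≤ qoriaV3VI_φ ∧ qoriaV3VI_δ1 ∈ Ioo (-(π / 2)) (π / 2) := by
  refine ⟨arcsin_nonneg.2 (by norm_num), ?_, arcsin_lt_pi_div_two.2 (by norm_num)⟩
  unfold qoriaV3VI_δ1
  have := arcsin_pos.2 (show (0 : ℝ) < 7644 / 8485 by norm_num)
  linarith [pi_pos]

/-! ## §3 Certified enclosures -/

/-- Certified `0.1553 < φ′ < 0.1554` (float `0.1553290`). -/
theorem φ_bounds : (1553 / 10000 : ℝ) < qoriaV3VI_φ ∧ qoriaV3VI_φ < 1554 / 10000 := by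
  have hc : cos (arcsin (10280 / 66449 : ℝ)) = 65649 / 66449 := cos_φ
  unfold qoriaV3VI_φ
  constructor
  · refine arcsin_gt_of_chain hc (by norm_num) (by linarith [pi_gt_three]) ?_ ?_ ?_ ?_ ?_ <;>
      norm_num [dbl, cosLower4]
  · refine arcsin_lt_of_chain hc (by norm_num) (by linarith [pi_gt_three]) ?_
    norm_num [dbl, cosUpper4]

/-- Certified `1.1217 < δ₁′ < 1.1219` (float `1.1218016`; five-doubling lower chain). -/
theorem δ1_bounds : (11217 / 10000 : ℝ) < qoriaV3VI_δ1 ∧ qoriaV3VI_δ1 < 11219 / 10000 := by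
  have hc : cos (arcsin (7644 / 8485 : ℝ)) = 3683 / 8485 := cos_δ1
  unfold qoriaV3VI_δ1
  constructor
  · refine arcsin_gt_of_chain5 hc (by norm_num) (by linarith [pi_gt_three]) ?_ ?_ ?_ ?_ ?_ ?_ <;>
      norm_num [dbl, cosLower5]
  · refine arcsin_lt_of_chain hc (by norm_num) (by linarith [pi_gt_three]) ?_
    norm_num [dbl, cosUpper4]

/-- Certified `1.8642 < δ_maxVI′ < 1.8647` (float `1.864462`; printed notion (V-20)–(V-21)). -/
theorem δmax_bounds : (18642 / 10000 : ℝ) < qoriaV3VI_δmax ∧ qoriaV3VI_δmax < 18647 / 10000 := by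
  obtain ⟨h1, h2⟩ := φ_bounds
  obtain ⟨h3, h4⟩ := δ1_bounds
  have hπ1 := pi_gt_d6
  have hπ2 := pi_lt_d6
  norm_num at hπ1 hπ2
  unfold qoriaV3VI_δmax
  constructor <;> linarith

/-- `δ₀′ ≤ δ₁′ − φ′` (indeed `0.2014 < 0.966`) and `δ_maxVI′ < 2π` facts used below. -/
theorem δ0_le_rest : qoriaV3p08_δ0 ≤ qoriaV3VI_δ1 - qoriaV3VI_φ := by
  linarith [δ0_bounds.2, δ1_bounds.1, φ_bounds.2]

/-- **Certified VI clearing time of the instance:** `0.1654 s < t_cVI′ < 0.1655 s`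
(`t_cVI′ = (δ_maxVI′ − δ₀′)/(k_i p*′) = tcSat δ₀′ δ_maxVI′`, `k_i p*′ = 11246400/1118813`; float `165.45` ms;
PRINTED «`t_cVI = 165` ms» [cite: Qoria2020, §V.3.4; Fig. V-16] — VALIDATED comparator). -/
theorem tcVI_bounds :
    (1654 / 10000 : ℝ) < qoriaV3p08.tcSat qoriaV3p08_δ0 qoriaV3VI_δmax ∧
      qoriaV3p08.tcSat qoriaV3p08_δ0 qoriaV3VI_δmax < 1655 / 10000 := by
  obtain ⟨h1, h2⟩ := δ0_bounds
  obtain ⟨h5, h6⟩ := φ_bounds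
  obtain ⟨h7, h8⟩ := δ1_bounds
  have hπ1 := pi_gt_d6
  have hπ2 := pi_lt_d6
  norm_num at hπ1 hπ2
  unfold ReducedParams.tcSat qoriaV3VI_δmax
  simp only [qoriaV3p08]
  constructor
  · rw [lt_div_iff₀ (by norm_num)]; linarith
  · rw [div_lt_iff₀ (by norm_num)]; linarith

/-- **The certified RANKING of the three clearing times of the instance:** `t_cSAT′ < t_cVI′ < t_cc′`
(`< 0.0637 < 0.1654` and `0.1655 < 0.272`; `tcSat_bounds`, `tcc_bounds` of p549392) — the print's
«VI: transient stability +, CSA: −» [cite: Qoria2020, Table V-2; Fig. V-15] as two inequalities of the models. -/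
theorem tcSat_lt_tcVI_lt_tcc :
    qoriaV3p08.tcSat qoriaV3p08_δ0 qoriaV3p08_δm < qoriaV3p08.tcSat qoriaV3p08_δ0 qoriaV3VI_δmax ∧
      qoriaV3p08.tcSat qoriaV3p08_δ0 qoriaV3VI_δmax < qoriaV3p08.tcc qoriaV3p08_δ0 := by
  obtain ⟨-, h2⟩ := tcSat_bounds
  obtain ⟨h3, h4⟩ := tcVI_bounds
  obtain ⟨h5, -⟩ := tcc_bounds
  constructor <;> linarith

/-! ## §4 The dichotomy on the instance, hypothesis-free -/

/-- **«QORIA-V3-VI-P08», recovery side.** Every bolted fault of duration `0 < t_f < t_cVI′` (in particular every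
`t_f ≤ 0.1654` s) cleared onto the maximal-VI curve: for EVERY release instant `t_d ≥ 0`, every post-fault motion
(maximal-VI curve on `[0, t_d]`, unlimited curve after) returns to `δ₀′` [cite: Qoria2020, §V.3.5 Fig. V-16.a
«recovers … `t_fault ≤ t_cVI`»]. MODELLED: M_droop1+VI; nothing about any converter. -/
theorem vi_recovers {tf : ℝ} (htf : 0 < tf)
    (hlt : tf < qoriaV3p08.tcSat qoriaV3p08_δ0 qoriaV3VI_δmax) {td : ℝ} (htd : 0 ≤ td) {δ : ℝ → ℝ}
    (hvi : ∀ t ∈ Icc 0 td, HasDerivWithinAt δ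
      (qoriaV3p08.dδFirstOrderLossy 1 1 qoriaV3VI_RT qoriaV3VI_XT (δ t)) (Icc 0 td) t)
    (hunl : qoriaV3p08.IsFirstOrderSolutionOn (fun s => δ (td + s)) (Ici 0))
    (h0 : δ 0 = qoriaV3p08.faultOn qoriaV3p08_δ0 tf) :
    Tendsto δ atTop (𝓝 qoriaV3p08_δ0) := by
  have h := (ReducedParams.vi_cct_exact (P := qoriaV3p08) rfl (by norm_num [qoriaV3p08])
    (by norm_num [qoriaV3p08]) (by norm_num [qoriaV3p08]) δ0_mem power_balance Z_pos.ne' RT_XT_eq.1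
    RT_XT_eq.2 (by rw [one_mul]; exact div_pos one_pos Z_pos) angles_mem.1 angles_mem.2 vi_balance
    δ0_le_rest htf).1
  exact h hlt td htd δ hvi hunl h0

/-- **«QORIA-V3-VI-P08», loss side.** Every bolted fault of duration `t_f ∈ (t_cVI′, 1/2]` s (in particular
every `t_f ∈ [0.1655, 0.5]` s) cleared onto the maximal-VI curve, the VI kept at its maximum: the angle stays
above `δ_maxVI′` and tends to `2π + δ₁′ − φ′` — no return [cite: Qoria2020, Fig. V-16.b «loses the synchronism
when `t_fault > t_cVI`» (175 ms)]. MODELLED: M_droop1+VI with the VI at its maximum throughout. -/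
theorem vi_loses {tf : ℝ} (hlt : qoriaV3p08.tcSat qoriaV3p08_δ0 qoriaV3VI_δmax < tf) (htf : tf ≤ 1 / 2)
    {δ : ℝ → ℝ}
    (hvi : ∀ t ∈ Ici (0:ℝ), HasDerivWithinAt δ
      (qoriaV3p08.dδFirstOrderLossy 1 1 qoriaV3VI_RT qoriaV3VI_XT (δ t)) (Ici 0) t)
    (h0 : δ 0 = qoriaV3p08.faultOn qoriaV3p08_δ0 tf) :
    (∀ t, 0 ≤ t → qoriaV3VI_δmax < δ t) ∧ Tendsto δ atTop (𝓝 (2 * π + qoriaV3VI_δ1 - qoriaV3VI_φ)) := by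
  have htf0 : 0 < tf := lt_trans (by norm_num : (0 : ℝ) < 1654 / 10000) (tcVI_bounds.1.trans hlt)
  have h2π : qoriaV3p08.faultOn qoriaV3p08_δ0 tf < 2 * π + qoriaV3VI_δ1 - qoriaV3VI_φ := by
    unfold ReducedParams.faultOn
    simp only [qoriaV3p08]
    have := δ0_bounds.2
    have := δ1_bounds.1
    have := φ_bounds.2
    nlinarith [pi_gt_d2]
  have h := (ReducedParams.vi_cct_exact (P := qoriaV3p08) rfl (by norm_num [qoriaV3p08])
    (by norm_num [qoriaV3p08]) (by norm_num [qoriaV3p08]) δ0_mem power_balance Z_pos.ne' RT_XT_eq.1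
    RT_XT_eq.2 (by rw [one_mul]; exact div_pos one_pos Z_pos) angles_mem.1 angles_mem.2 vi_balance
    δ0_le_rest htf0).2 hlt h2π δ hvi h0
  exact ⟨fun t ht => by have := h.1 t ht; unfold qoriaV3VI_δmax; linarith, h.2⟩

end qoriaV3p08

end Summit.Ventures.GridStability.Models.InverterDroop

end
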